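import Literature.Geometry.GaugeTheory.AdaptedFramesTraceHessian
import Literature.Geometry.GaugeTheory.SpincStructureCovDerivPairingForm
import Literature.Geometry.GaugeTheory.SpincStructureDivergence
import Literature.Geometry.GaugeTheory.SeibergWittenGaugeInvariance
import Literature.Geometry.Lorentzian.CurvatureSymmetries
import HarnessLib

/-!
# The energy identity `d(Im ᾱ∇_aα) = Im(∇_aᾱ ∧ ∇_aα) + |α|² F_a`

Topic `Literature/Geometry/GaugeTheory`; the pointwise identity behind Hutchings–Taubes (4.18)
(`∫|∇_aα|² = ∫ 2|∂̄_aα|² + ∫ i⟨ω, F_a⟩|α|²`, Taubes's "Bogomolny" rearrangement of the energy of a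
section `α` of the trivial bundle with unitary connection `∇_a = d + iA`): for a smooth complex
function `α` and a smooth real 1-form `A` on `X`, the real 1-form `θ = Im(ᾱ ∇_aα)`
(`θ(v) = Im(ᾱ dα(v)) + A(v)|α|²`) satisfies, on any pair of fields,

  `dθ(u, v) = 2 Im(conj(∇_uα) ∇_vα) + |α|² dA(u, v)`,

and `|∇_uα + i∇_vα|² - |∇_uα - i∇_vα|² = -4 Im(conj(∇_uα) ∇_vα)`; so on a unitary frame
`dθ(e₀,e₁) + dθ(e₂,e₃) = -½(|∂̄-part|² - |∂-part|²) + |α|²(dA(e₀,e₁) + dA(e₂,e₃))`, whose integral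
against `ω ∧ ω` vanishes (`Symplectic/…`, Stokes).

* `connDeriv α A x v = dα(v) + iA(v)α` and the real 1-form `energyForm α A = Im(ᾱ ∇_aα)`, smooth;
* `complexDeriv_apply_mlieBracket` — `dα([V,W]) = V(Wα) - W(Vα)` for complex `α`;
* **`mextDeriv_energyForm_apply`** — the displayed identity on smooth fields.

PROVED, 0 named facts.

## References

* M. Hutchings, C. H. Taubes, *An introduction to the Seiberg–Witten equations on symplectic
  manifolds*, IAS/Park City Math. Ser. 7 (1999; AMS reprint 2006), §4.5 (4.14), (4.18). [HutchingsTaubes2006]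
* C. H. Taubes, *The Seiberg–Witten and Gromov invariants*, Math. Res. Lett. 2 (1995) 221–238,
  §5 Step 3 (5.5). [Taubes1995]
-/

noncomputable section

open scoped Manifold ContDiff Topology Bundle ComplexConjugate
open Set Function Filter Bundle VectorField Complex
open Literature.Geometry.Lorentzian (PseudoRiemannianMetric contMDiffAt_clm_apply_iff)
open Literature.Topology.FourManifolds (SmoothOrientation)
open Literature.Geometry.Kaehler (MForm IsSmoothForm mextDeriv)

namespace Literature.Geometry.GaugeTheory

variable {X : Type*} [TopologicalSpace X] [ChartedSpace (EuclideanSpace ℝ (Fin 4)) X] [IsManifold (𝓡 4) ∞ X]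

/-! ### Complex calculus: real and imaginary parts, the bracket as a commutator -/

omit [IsManifold (𝓡 4) ∞ X] in
/-- Products of `C^m` complex functions on the manifold are `C^m`. [folklore] -/
theorem ContMDiffAt.mul_complex' {m : ℕ∞ω} {f f' : X → ℂ} {x : X} (hf : ContMDiffAt (𝓡 4) 𝓘(ℝ, ℂ) m f x)
    (hf' : ContMDiffAt (𝓡 4) 𝓘(ℝ, ℂ) m f' x) : ContMDiffAt (𝓡 4) 𝓘(ℝ, ℂ) m (fun y ↦ f y * f' y) x :=
  ((contDiff_mul (𝕜 := ℝ) (𝔸 := ℂ)).of_le le_top).comp_contMDiffAt (hf.prodMk_space hf')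

omit [IsManifold (𝓡 4) ∞ X] in
/-- The derivative of the imaginary part is the imaginary part of the derivative. [folklore] -/
theorem mvfderiv_im_eq {P : X → ℂ} {x : X} (hP : MDifferentiableAt (𝓡 4) 𝓘(ℝ, ℂ) P x) (v : TangentSpace (𝓡 4) x) :
    mvfderiv (𝓡 4) (fun y ↦ (P y).im) x v = (complexDeriv P x v).im := by
  have him : HasMFDerivAt (𝓡 4) 𝓘(ℝ, ℝ) (fun y ↦ (P y).im) x
      ((Complex.imCLM : ℂ →L[ℝ] ℝ).comp (mfderiv (𝓡 4) 𝓘(ℝ, ℂ) P x)) :=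
    (Complex.imCLM.hasMFDerivAt (x := P x)).comp x hP.hasMFDerivAt
  unfold mvfderiv
  rw [him.mfderiv]
  rfl

omit [IsManifold (𝓡 4) ∞ X] in
/-- `dα(v) = d(Re α)(v) + i d(Im α)(v)`. [folklore] -/
theorem complexDeriv_eq_re_add_im {P : X → ℂ} {x : X} (hP : MDifferentiableAt (𝓡 4) 𝓘(ℝ, ℂ) P x)
    (v : TangentSpace (𝓡 4) x) :
    complexDeriv P x v = ((mvfderiv (𝓡 4) (fun y ↦ (P y).re) x v : ℝ) : ℂ) +
      ((mvfderiv (𝓡 4) (fun y ↦ (P y).im) x v : ℝ) : ℂ) * I := by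
  rw [mvfderiv_re_eq hP, mvfderiv_im_eq hP]
  exact (Complex.re_add_im _).symm

/-- **The Lie bracket is the commutator of the derivations, for complex functions**:
`dα_x([V, W]_x) = V_x(Wα) - W_x(Vα)` for `α` of class `C²` near `x` and fields of class `C²` at `x`
(real and imaginary parts of the real statement `mvfderiv_apply_mlieBracket`). [cite: GallotHulinLafontaine2004, Def. 1.52 bis] -/
theorem complexDeriv_apply_mlieBracket {α : X → ℂ} {x : X} (hα : ∀ᶠ y in 𝓝 x, ContMDiffAt (𝓡 4) 𝓘(ℝ, ℂ) 2 α y)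
    {V W : Π y : X, TangentSpace (𝓡 4) y}
    (hV : ContMDiffAt (𝓡 4) ((𝓡 4).prod 𝓘(ℝ, EuclideanSpace ℝ (Fin 4))) 2
      (fun y : X ↦ TotalSpace.mk' (EuclideanSpace ℝ (Fin 4)) (E := (TangentSpace (𝓡 4) : X → Type _)) y (V y)) x)
    (hW : ContMDiffAt (𝓡 4) ((𝓡 4).prod 𝓘(ℝ, EuclideanSpace ℝ (Fin 4))) 2
      (fun y : X ↦ TotalSpace.mk' (EuclideanSpace ℝ (Fin 4)) (E := (TangentSpace (𝓡 4) : X → Type _)) y (W y)) x) :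
    complexDeriv α x (mlieBracket (𝓡 4) V W x) =
      complexDeriv (fun y ↦ complexDeriv α y (W y)) x (V x) - complexDeriv (fun y ↦ complexDeriv α y (V y)) x (W x) := by
  have hαx : ContMDiffAt (𝓡 4) 𝓘(ℝ, ℂ) 2 α x := hα.self_of_nhds
  have hre : ContMDiffAt (𝓡 4) 𝓘(ℝ, ℝ) 2 (fun y ↦ (α y).re) x := Complex.reCLM.contDiff.comp_contMDiffAt hαx
  have him : ContMDiffAt (𝓡 4) 𝓘(ℝ, ℝ) 2 (fun y ↦ (α y).im) x := Complex.imCLM.contDiff.comp_contMDiffAt hαx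
  have hR := Literature.Geometry.Lorentzian.mvfderiv_apply_mlieBracket (I := 𝓡 4) hre hV hW
  have hI := Literature.Geometry.Lorentzian.mvfderiv_apply_mlieBracket (I := 𝓡 4) him hV hW
  -- the inner derivatives, real and imaginary parts
  have hd : ∀ᶠ y in 𝓝 x, MDifferentiableAt (𝓡 4) 𝓘(ℝ, ℂ) α y := by
    filter_upwards [hα] with y hy using hy.mdifferentiableAt two_ne_zero
  have hinner : ∀ U : Π y : X, TangentSpace (𝓡 4) y,
      ContMDiffAt (𝓡 4) ((𝓡 4).prod 𝓘(ℝ, EuclideanSpace ℝ (Fin 4))) 2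
        (fun y : X ↦ TotalSpace.mk' (EuclideanSpace ℝ (Fin 4)) (E := (TangentSpace (𝓡 4) : X → Type _)) y (U y)) x →
      MDifferentiableAt (𝓡 4) 𝓘(ℝ, ℂ) (fun y ↦ complexDeriv α y (U y)) x ∧
        (fun y ↦ (complexDeriv α y (U y)).re) =ᶠ[𝓝 x] (fun y ↦ mvfderiv (𝓡 4) (fun z ↦ (α z).re) y (U y)) ∧
        (fun y ↦ (complexDeriv α y (U y)).im) =ᶠ[𝓝 x] (fun y ↦ mvfderiv (𝓡 4) (fun z ↦ (α z).im) y (U y)) := by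
    intro U hU
    refine ⟨?_, ?_, ?_⟩
    · -- differentiability of `y ↦ dα_y(U y)`: real and imaginary parts are `C¹`
      have h1 : ContMDiffAt (𝓡 4) 𝓘(ℝ, ℝ) 1 (fun y ↦ mvfderiv (𝓡 4) (fun z ↦ (α z).re) y (U y)) x :=
        Literature.Geometry.Lorentzian.contMDiffAt_mvfderiv_apply_of_le (m := 1) hre (hU.of_le one_le_two)
      have h2 : ContMDiffAt (𝓡 4) 𝓘(ℝ, ℝ) 1 (fun y ↦ mvfderiv (𝓡 4) (fun z ↦ (α z).im) y (U y)) x :=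
        Literature.Geometry.Lorentzian.contMDiffAt_mvfderiv_apply_of_le (m := 1) him (hU.of_le one_le_two)
      have h12 : ContMDiffAt (𝓡 4) 𝓘(ℝ, ℂ) 1 (fun y ↦ ((mvfderiv (𝓡 4) (fun z ↦ (α z).re) y (U y) : ℝ) : ℂ) +
          ((mvfderiv (𝓡 4) (fun z ↦ (α z).im) y (U y) : ℝ) : ℂ) * I) x :=
        (Complex.ofRealCLM.contDiff.comp_contMDiffAt h1).add
          (ContMDiffAt.mul_complex' (Complex.ofRealCLM.contDiff.comp_contMDiffAt h2) contMDiffAt_const)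
      refine (h12.mdifferentiableAt one_ne_zero).congr_of_eventuallyEq ?_
      filter_upwards [hd] with y hy
      exact complexDeriv_eq_re_add_im hy (U y)
    · filter_upwards [hd] with y hy using (mvfderiv_re_eq hy (U y)).symm
    · filter_upwards [hd] with y hy using (mvfderiv_im_eq hy (U y)).symm
  obtain ⟨hWd, hWre, hWim⟩ := hinner W hW
  obtain ⟨hVd, hVre, hVim⟩ := hinner V hV
  apply Complex.ext
  · rw [Complex.sub_re, ← mvfderiv_re_eq hWd, ← mvfderiv_re_eq hVd, ← mvfderiv_re_eq hd.self_of_nhds,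
      Literature.Geometry.Lorentzian.mvfderiv_congr_nhds hWre, Literature.Geometry.Lorentzian.mvfderiv_congr_nhds hVre]
    exact hR
  · rw [Complex.sub_im, ← mvfderiv_im_eq hWd, ← mvfderiv_im_eq hVd, ← mvfderiv_im_eq hd.self_of_nhds,
      Literature.Geometry.Lorentzian.mvfderiv_congr_nhds hWim, Literature.Geometry.Lorentzian.mvfderiv_congr_nhds hVim]
    exact hI

omit [IsManifold (𝓡 4) ∞ X] in
/-- The differential of `|α|²`: `d|α|²(v) = 2 Re(ᾱ dα(v))`. [folklore] -/
theorem mvfderiv_normSq_comp {α : X → ℂ} {x : X} (hα : MDifferentiableAt (𝓡 4) 𝓘(ℝ, ℂ) α x) (v : TangentSpace (𝓡 4) x) :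
    mvfderiv (𝓡 4) (fun y ↦ Complex.normSq (α y)) x v = 2 * (conj (α x) * complexDeriv α x v).re := by
  have heq : (fun y ↦ Complex.normSq (α y)) = fun y ↦ (conj (α y) * α y).re := by
    funext y
    rw [← Complex.normSq_eq_conj_mul_self, Complex.ofReal_re]
  have hconj : MDifferentiableAt (𝓡 4) 𝓘(ℝ, ℂ) (fun y ↦ conj (α y)) x :=
    ((Complex.conjCLE : ℂ ≃L[ℝ] ℂ).hasMFDerivAt (x := α x)).comp x hα.hasMFDerivAt |>.mdifferentiableAt
  rw [heq, mvfderiv_re_eq (P := fun y ↦ conj (α y) * α y) (hconj.mul hα), complexDeriv_mul_fun hconj hα,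
    complexDeriv_conj_fun hα]
  have h : conj (α x) * complexDeriv α x v + α x * conj (complexDeriv α x v) =
      conj (α x) * complexDeriv α x v + conj (conj (α x) * complexDeriv α x v) := by
    rw [map_mul, Complex.conj_conj, mul_comm (α x)]
  rw [h, Complex.add_re, Complex.conj_re]
  ring

/-! ### The connection derivative `∇_a α = dα + iAα` and the 1-form `Im(ᾱ ∇_aα)` -/

/-- **`∇_v α = dα(v) + iA(v)α`**, the covariant derivative of a complex function for the unitary
connection `d + iA` on the trivial line bundle. [cite: HutchingsTaubes2006, §4.3] -/
def connDeriv (α : X → ℂ) (A : RealOneForm X) (x : X) (v : TangentSpace (𝓡 4) x) : ℂ :=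
  complexDeriv α x v + I * A x v * α x

/-- **The real 1-form `θ = Im(ᾱ ∇_aα)`**: `θ(v) = Im(ᾱ dα(v)) + A(v)|α|²` (gauge invariant; `½ d|α|²`
is its real counterpart). [cite: HutchingsTaubes2006, §4.5] -/
def energyForm (α : X → ℂ) (A : RealOneForm X) : RealOneForm X := fun x ↦
  (Complex.imCLM : ℂ →L[ℝ] ℝ).comp ((ContinuousLinearMap.mul ℝ ℂ (conj (α x))).comp
    (show TangentSpace (𝓡 4) x →L[ℝ] ℂ from mfderiv (𝓡 4) 𝓘(ℝ, ℂ) α x)) +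
    Complex.normSq (α x) • A x

omit [IsManifold (𝓡 4) ∞ X] in
/-- `θ(v) = Im(ᾱ dα(v)) + |α|² A(v) = Im(ᾱ ∇_vα)`. [cite: HutchingsTaubes2006, §4.5] -/
theorem energyForm_apply (α : X → ℂ) (A : RealOneForm X) (x : X) (v : TangentSpace (𝓡 4) x) :
    energyForm α A x v = (conj (α x) * complexDeriv α x v).im + Complex.normSq (α x) * A x v := by
  simp [energyForm, complexDeriv]
  rfl

omit [IsManifold (𝓡 4) ∞ X] in
/-- `θ(v) = Im(ᾱ ∇_vα)`. [cite: HutchingsTaubes2006, §4.5] -/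
theorem energyForm_apply_eq_im_connDeriv (α : X → ℂ) (A : RealOneForm X) (x : X) (v : TangentSpace (𝓡 4) x) :
    energyForm α A x v = (conj (α x) * connDeriv α A x v).im := by
  rw [energyForm_apply, connDeriv, mul_add, Complex.add_im]
  congr 1
  simp [Complex.mul_im, Complex.mul_re, Complex.normSq_apply]
  ring_nf

/-- **The covector field `w ↦ θ(e.symmL w)` is smooth at `x₀`** for smooth `α` and `A`. [folklore] -/
theorem contMDiffAt_energyForm_comp_symmL {α : X → ℂ} (hα : ContMDiff (𝓡 4) 𝓘(ℝ, ℂ) ∞ α) {A : RealOneForm X}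
    (hA : ∀ y, A.SmoothAt y) (x₀ : X) :
    ContMDiffAt (𝓡 4) 𝓘(ℝ, EuclideanSpace ℝ (Fin 4) →L[ℝ] ℝ) ∞ (fun x ↦ (energyForm α A x).comp
      ((trivializationAt (EuclideanSpace ℝ (Fin 4)) (TangentSpace (𝓡 4) : X → Type _) x₀).symmL ℝ x)) x₀ := by
  rw [contMDiffAt_clm_apply_iff]
  intro w
  have hW := contMDiffAt_symmL_trivializationAt x₀ w
  have hconj : ContMDiffAt (𝓡 4) 𝓘(ℝ, ℂ) ∞ (fun x ↦ conj (α x)) x₀ := Complex.conjCLE.contDiff.comp_contMDiffAt (hα x₀)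
  have hd : ContMDiffAt (𝓡 4) 𝓘(ℝ, ℂ) ∞ (fun x ↦ complexDeriv α x
      ((trivializationAt (EuclideanSpace ℝ (Fin 4)) (TangentSpace (𝓡 4) : X → Type _) x₀).symmL ℝ x w)) x₀ :=
    contMDiffAt_complexDeriv_apply (hα x₀) hW
  have hn : ContMDiffAt (𝓡 4) 𝓘(ℝ, ℝ) ∞ (fun x ↦ Complex.normSq (α x)) x₀ := by
    have : (fun x ↦ Complex.normSq (α x)) = fun x ↦ ‖α x‖ ^ 2 := funext fun x ↦ Complex.normSq_eq_norm_sq _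
    rw [this]
    exact (contDiff_norm_sq ℝ (n := ∞)).comp_contMDiffAt (hα x₀)
  have hAw : ContMDiffAt (𝓡 4) 𝓘(ℝ, ℝ) ∞ (fun x ↦ A x
      ((trivializationAt (EuclideanSpace ℝ (Fin 4)) (TangentSpace (𝓡 4) : X → Type _) x₀).symmL ℝ x w)) x₀ :=
    SpincStructure.contMDiffAt_form_apply_field (hA x₀) hW
  have h := (Complex.imCLM.contDiff.comp_contMDiffAt (ContMDiffAt.mul_complex hconj hd)).add (hn.mul hAw)
  refine h.congr_of_eventuallyEq (Eventually.of_forall fun x ↦ ?_)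
  simp only [ContinuousLinearMap.comp_apply, energyForm_apply]
  rfl

/-- **`Im(ᾱ ∇_aα)` is a smooth 1-form** for smooth `α` and `A`. [folklore] -/
theorem smoothAt_energyForm {α : X → ℂ} (hα : ContMDiff (𝓡 4) 𝓘(ℝ, ℂ) ∞ α) {A : RealOneForm X}
    (hA : ∀ y, A.SmoothAt y) (x₀ : X) : (energyForm α A).SmoothAt x₀ := by
  obtain ⟨F, hF⟩ : ∃ F : X → EuclideanSpace ℝ (Fin 4) →L[ℝ] ℝ, F = fun x ↦ (energyForm α A x).comp
      ((trivializationAt (EuclideanSpace ℝ (Fin 4)) (TangentSpace (𝓡 4) : X → Type _) x₀).symmL ℝ x) := ⟨_, rfl⟩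
  have hFs : ContMDiffAt (𝓡 4) 𝓘(ℝ, EuclideanSpace ℝ (Fin 4) →L[ℝ] ℝ) ∞ F x₀ := hF ▸ contMDiffAt_energyForm_comp_symmL hα hA x₀
  have hG : ContMDiffAt (𝓡 4) 𝓘(ℝ, (EuclideanSpace ℝ (Fin 4)) [⋀^Fin 1]→L[ℝ] ℝ) ∞
      ((fun L : EuclideanSpace ℝ (Fin 4) →L[ℝ] ℝ ↦
        ContinuousAlternatingMap.ofSubsingleton ℝ (EuclideanSpace ℝ (Fin 4)) ℝ (0 : Fin 1) L) ∘ F) x₀ :=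
    (ContinuousAlternatingMap.ofSubsingletonLIE (𝕜 := ℝ) (E := EuclideanSpace ℝ (Fin 4)) (F := ℝ)
      (0 : Fin 1)).toContinuousLinearEquiv.contDiff.comp_contMDiffAt hFs
  have hG' : ContDiffWithinAt ℝ ∞
      (((fun L : EuclideanSpace ℝ (Fin 4) →L[ℝ] ℝ ↦
        ContinuousAlternatingMap.ofSubsingleton ℝ (EuclideanSpace ℝ (Fin 4)) ℝ (0 : Fin 1) L) ∘ F) ∘
        (extChartAt (𝓡 4) x₀).symm) (range (𝓡 4)) (extChartAt (𝓡 4) x₀ x₀) := by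
    simpa using (contMDiffAt_iff.1 hG).2
  have hev : ∀ y ∈ (extChartAt (𝓡 4) x₀).target, (energyForm α A).toMForm.inChart x₀ y =
      ContinuousAlternatingMap.ofSubsingleton ℝ (EuclideanSpace ℝ (Fin 4)) ℝ (0 : Fin 1) (F ((extChartAt (𝓡 4) x₀).symm y)) := by
    intro y hy
    have hx : (extChartAt (𝓡 4) x₀).symm y ∈ (chartAt (EuclideanSpace ℝ (Fin 4)) x₀).source := by
      rw [← extChartAt_source (𝓡 4)]
      exact (extChartAt (𝓡 4) x₀).map_target hy
    have hD : mfderivWithin 𝓘(ℝ, EuclideanSpace ℝ (Fin 4)) (𝓡 4) (extChartAt (𝓡 4) x₀).symm (range (𝓡 4)) y =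
        (trivializationAt (EuclideanSpace ℝ (Fin 4)) (TangentSpace (𝓡 4) : X → Type _) x₀).symmL ℝ
          ((extChartAt (𝓡 4) x₀).symm y) := by
      rw [TangentBundle.symmL_trivializationAt hx, (extChartAt (𝓡 4) x₀).right_inv hy]
    ext v
    rw [Literature.Geometry.Kaehler.MForm.inChart_apply, hD, ContinuousAlternatingMap.ofSubsingleton_apply_apply]
    simp only [hF, RealOneForm.toMForm_apply, ContinuousLinearMap.comp_apply]
    rfl
  unfold RealOneForm.SmoothAt
  refine hG'.congr_of_eventuallyEq ?_ (hev _ (mem_extChartAt_target x₀))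
  filter_upwards [extChartAt_target_mem_nhdsWithin x₀] with y hy using hev y hy

/-! ### The identity `dθ = 2 Im(∇ᾱ ⊗ ∇α) + |α|² dA` on fields -/

/-- **`|p + iq|² - |p - iq|² = -4 Im(p̄ q)`** (the `∂̄`/`∂` splitting of the energy). [folklore] -/
theorem normSq_add_I_mul_sub_normSq_sub_I_mul (p q : ℂ) :
    Complex.normSq (p + I * q) - Complex.normSq (p - I * q) = -4 * (conj p * q).im := by
  simp [Complex.normSq_apply, Complex.mul_re, Complex.mul_im]
  ring

/-- **The energy identity on fields**: for smooth `α`, `A` and fields `V`, `W` of class `C²` at `x`,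
`dθ(V, W) = 2 Im(conj(∇_Vα) ∇_Wα) + |α|² dA(V, W)` for `θ = Im(ᾱ ∇_aα)`, `∇ = d + iA`
(Warner's formula for `dθ` and `dA` on the fields, the Leibniz rules, and `dα([V,W]) = V(Wα) - W(Vα)`).
[cite: HutchingsTaubes2006, §4.5 (4.14), (4.18)] -/
theorem mextDeriv_energyForm_apply {α : X → ℂ} (hα : ContMDiff (𝓡 4) 𝓘(ℝ, ℂ) ∞ α) {A : RealOneForm X}
    (hA : ∀ y, A.SmoothAt y) {x : X} {V W : Π y : X, TangentSpace (𝓡 4) y}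
    (hV : ContMDiffAt (𝓡 4) ((𝓡 4).prod 𝓘(ℝ, EuclideanSpace ℝ (Fin 4))) ∞
      (fun y : X ↦ TotalSpace.mk' (EuclideanSpace ℝ (Fin 4)) (E := (TangentSpace (𝓡 4) : X → Type _)) y (V y)) x)
    (hW : ContMDiffAt (𝓡 4) ((𝓡 4).prod 𝓘(ℝ, EuclideanSpace ℝ (Fin 4))) ∞
      (fun y : X ↦ TotalSpace.mk' (EuclideanSpace ℝ (Fin 4)) (E := (TangentSpace (𝓡 4) : X → Type _)) y (W y)) x) :
    mextDeriv (energyForm α A).toMForm x ![V x, W x] =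
      2 * (conj (connDeriv α A x (V x)) * connDeriv α A x (W x)).im +
        Complex.normSq (α x) * mextDeriv A.toMForm x ![V x, W x] := by
  have hVd := hV.mdifferentiableAt (by simp)
  have hWd := hW.mdifferentiableAt (by simp)
  have hαd : ∀ y, MDifferentiableAt (𝓡 4) 𝓘(ℝ, ℂ) α y := fun y ↦ (hα y).mdifferentiableAt (by simp)
  have hconjd : ∀ y, MDifferentiableAt (𝓡 4) 𝓘(ℝ, ℂ) (fun z ↦ conj (α z)) y := fun y ↦
    ((Complex.conjCLE : ℂ ≃L[ℝ] ℂ).hasMFDerivAt (x := α y)).comp y (hαd y).hasMFDerivAt |>.mdifferentiableAt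
  -- Warner's formula for `θ` and for `A`
  have hWθ := Literature.Geometry.Kaehler.mextDeriv_apply_vectorField (α := (energyForm α A).toMForm)
    (smoothAt_energyForm hα hA x).differentiableWithinAt hVd hWd
  have hWA := Literature.Geometry.Kaehler.mextDeriv_apply_vectorField (α := A.toMForm) (hA x).differentiableWithinAt hVd hWd
  -- the bracket as a commutator
  have hbr := complexDeriv_apply_mlieBracket (α := α) (x := x)
    (Eventually.of_forall fun y ↦ (hα y).of_le (inferInstance : ENat.LEInfty (2 : ℕ∞ω)).out)
    (hV.of_le (inferInstance : ENat.LEInfty (2 : ℕ∞ω)).out) (hW.of_le (inferInstance : ENat.LEInfty (2 : ℕ∞ω)).out)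
  -- differentiability of the pieces along a smooth field
  have hpieces : ∀ {U : Π y : X, TangentSpace (𝓡 4) y},
      ContMDiffAt (𝓡 4) ((𝓡 4).prod 𝓘(ℝ, EuclideanSpace ℝ (Fin 4))) ∞
        (fun y : X ↦ TotalSpace.mk' (EuclideanSpace ℝ (Fin 4)) (E := (TangentSpace (𝓡 4) : X → Type _)) y (U y)) x →
      MDifferentiableAt (𝓡 4) 𝓘(ℝ, ℂ) (fun y ↦ complexDeriv α y (U y)) x ∧
        MDifferentiableAt (𝓡 4) 𝓘(ℝ, ℝ) (fun y ↦ A y (U y)) x := fun hU ↦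
    ⟨(contMDiffAt_complexDeriv_apply (hα x) hU).mdifferentiableAt (by simp),
      (SpincStructure.contMDiffAt_form_apply_field (hA x) hU).mdifferentiableAt (by simp)⟩
  obtain ⟨hdW, hAW⟩ := hpieces hW
  obtain ⟨hdV, hAV⟩ := hpieces hV
  have hn : MDifferentiableAt (𝓡 4) 𝓘(ℝ, ℝ) (fun y ↦ Complex.normSq (α y)) x := by
    have : (fun y ↦ Complex.normSq (α y)) = fun y ↦ ‖α y‖ ^ 2 := funext fun y ↦ Complex.normSq_eq_norm_sq _
    rw [this]
    exact ((contDiff_norm_sq ℝ (n := ∞)).comp_contMDiffAt (hα x)).mdifferentiableAt (by simp)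
  -- the derivative of `θ(U)` along `v`
  have hderiv : ∀ {U : Π y : X, TangentSpace (𝓡 4) y},
      MDifferentiableAt (𝓡 4) 𝓘(ℝ, ℂ) (fun y ↦ complexDeriv α y (U y)) x →
      MDifferentiableAt (𝓡 4) 𝓘(ℝ, ℝ) (fun y ↦ A y (U y)) x → ∀ v : TangentSpace (𝓡 4) x,
      mvfderiv (𝓡 4) (fun y ↦ (energyForm α A).toMForm y ![U y]) x v =
        (conj (complexDeriv α x v) * complexDeriv α x (U x) +
            conj (α x) * complexDeriv (fun y ↦ complexDeriv α y (U y)) x v).im +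
          (Complex.normSq (α x) * mvfderiv (𝓡 4) (fun y ↦ A y (U y)) x v +
            A x (U x) * (2 * (conj (α x) * complexDeriv α x v).re)) := by
    intro U hdU hAU v
    have hfun : (fun y ↦ (energyForm α A).toMForm y ![U y]) =
        (fun y ↦ (conj (α y) * complexDeriv α y (U y)).im) + ((fun y ↦ Complex.normSq (α y)) * fun y ↦ A y (U y)) := by
      funext y
      simp only [RealOneForm.toMForm_apply, Matrix.cons_val_zero, energyForm_apply, Pi.add_apply, Pi.mul_apply]
    have h1 : MDifferentiableAt (𝓡 4) 𝓘(ℝ, ℂ) (fun y ↦ conj (α y) * complexDeriv α y (U y)) x :=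
      (hconjd x).mul hdU
    have h1' : MDifferentiableAt (𝓡 4) 𝓘(ℝ, ℝ) (fun y ↦ (conj (α y) * complexDeriv α y (U y)).im) x :=
      ((Complex.imCLM.hasMFDerivAt (x := conj (α x) * complexDeriv α x (U x))).comp x h1.hasMFDerivAt).mdifferentiableAt
    rw [hfun, mvfderiv_add h1' (hn.mul hAU), mvfderiv_mul hn hAU]
    simp only [_root_.add_apply, FunLike.coe_smul, Pi.smul_apply, smul_eq_mul]
    rw [mvfderiv_im_eq h1, complexDeriv_mul_fun (hconjd x) hdU, complexDeriv_conj_fun (hαd x), mvfderiv_normSq_comp (hαd x)]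
    ring
  rw [hWθ, hderiv hdW hAW, hderiv hdV hAV, hWA]
  simp only [RealOneForm.toMForm_apply, Matrix.cons_val_zero, energyForm_apply, connDeriv, hbr]
  simp only [Complex.mul_im, Complex.mul_re, Complex.conj_re, Complex.conj_im, Complex.add_re, Complex.add_im, Complex.sub_re,
    Complex.sub_im, Complex.I_re, Complex.I_im, Complex.ofReal_re, Complex.ofReal_im, Complex.normSq_apply]
  ring

end Literature.Geometry.GaugeTheory

end
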